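import Summits.HodgeConjecture.HodgeConjecture.Theorems.R90S6TreeNormalFrameU2       -- ★ this seat (HF1, FILE A1): normal frames, `latticeTreeIso_apply_eq_self_iff_mapGL_le`; brings ★ A1-H FILE 1, ★ `HermitianLatticeTree*` (`mem_latt_mul_diagonal_iff`, `latt_mul_of_mem_glInt`), the `Valued`∕`ValuativeRel` bridge (`mem_glInt_iff_forall_v_le_one`, `v_le_one_iff_mem_integer`), ★ `CartanUnique.v_uniformizer_zpow`
import HarnessLib

/-!
# R90 · S6 — CARD HF1 (row E1.3.5.2.6, H side), FILE A2: THE COMPRESSION `δ = c·1 + (a−c)·E` ON FRAMED LATTICES — the column tests and the residual impossibility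
# (`Theorems/R90S6CompressionFrameTestU2.lean`)

Cell `hodgecm-mathlib`, crux H413 (`stmt-HodgeConjecture-24833`), route of record `HCCMUnconditional`; programme R90-TF, section S6 (base `R90-C14`), seat
R90-C14-p03 (g3); card HF1 «Fix AND FIRST SHELLS ON `X₂` FOR THE UNRAMIFIED-`E¹` COMPRESSIONS» (dealer R90-C14-plan (g2), R90 bus 2026-09-05T02:15:20Z).  Helper lane
`--supports stmt-HodgeConjecture-24833 --as helper`; THEOREMS ONLY (no definition, no instance, no notation, no named fact, no `sorry`).

THE ELEMENT (typ1 (g3)'s (E1) sheet letters): `δ` with matrix `!![e(a+c), −e(a−c); −e(a−c), e(a+c)]` (`2e = 1`, residue characteristic `≠ 2`: `v 2 = 1`; `a, c ∈ K¹` norm-one,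
DEPTH `n`: `Valued.v (a − c) = exp(−n)`) — the `{0,2}`-compression of Flicker's `t_1(a,b,c)`, the `U(1,1)`-part of `γ_H`.  ALGEBRA: `δ = c·1 + (a−c)·E`, `E = e(1 − J₂)` the
INTEGRAL idempotent onto the `a`-eigenline `K·(1,−1)` along the `c`-eigenline `K·(1,1)` (§1 `compression_mulVec`); so for `c ∈ 𝒪`, `δ·latt F ≤ latt F` iff both vectors
`(a−c) e (f_{0j} − f_{1j})·(1,−1)` lie in `latt F` (§1 `mapGL_latt_le_iff_compression`).
THE FRAME TESTS (§2).  In a frame `M = latt (P·diag(ϖ^α, ϖ^β))`, `P ∈ GL₂(𝒪)`, `α ≤ β`, ★ `mem_latt_mul_diagonal_iff` turns these memberships into the four inequalities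
`|ϖ|^{c_j − c_i}·|a − c|·|e (P_{0j} − P_{1j}) r_i| ≤ 1` (`c = (α, β)`, `r = P⁻¹(1,−1)`): all automatic when `β − α ≤ n` (**`mapGL_latt_frame_le_of_le`**), while for the normal
frame of level `N > n` the test `(i, j) = (1, 0)` forces `|(x − y)·r₁| < 1`, `(x, y)` the first column of `P` (**`v_lt_one_of_mapGL_latt_frame_le`**).
THE RESIDUAL IMPOSSIBILITY (§3 **`false_of_v_lt_one_of_frame`**): `|(x − y) r₁| < 1` says the residual column `(x̄, ȳ)` is an eigenvector of `Ē` (i.e. `x ≡ ±y`), and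
`|σ(x)y + σ(y)x| < 1` says it is ISOTROPIC for the residual hermitian form `antidiag(1,1)`; but the eigenlines `(1, ±1)` have `h̄ = ±2 ≠ 0` — concretely `2σ(x)x ∈ 𝔪`, so
`x, y ∈ 𝔪`, contradicting `det P ∈ 𝒪ˣ`.  FILE A3 combines §2–§3 with FILE A1's normal frames into `Fix_{X₂}(δ) = Ball(x₀, n)`.
HONEST LABEL: elementary lattice∕valuation algebra over ★ carriers; proves no printed statement, discharges no citation; count-neutral helper for HF1 ∕ (E1).
HC_CM is proved only modulo the 7 printed citations (2 remaining named inputs: hLiu418 = stmt-HodgeConjecture-24832, h413 = stmt-HodgeConjecture-24833) until rung 0 closes; REL ≠ ★ ≠ BUILT.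

## References
* [Rogawski1990] J. D. Rogawski, *Automorphic Representations of Unitary Groups in Three Variables*, Ann. of Math. Stud. 123 (1990): §4.9 pp. 54–56, §3.5–3.6.
* [LabesseLanglands1979] J.-P. Labesse, R. P. Langlands, *L-indistinguishability for SL(2)*, Canad. J. Math. 31 (1979): §§2–3 (rank one: fixed balls of elliptic elements).
* [Serre1980Trees] J.-P. Serre, *Trees* (1980): I.6.4, II.1.1.
* [Jacobowitz1962] R. Jacobowitz, *Hermitian forms over local fields*, Amer. J. Math. 84 (1962): §4, §7–§8.
* [Kottwitz1986BaseChangeUnits] R. E. Kottwitz, *Base change for unit elements of Hecke algebras*, Compositio Math. 60 (1986): §1 pp. 240–242, §3 (fixed lattices of units).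
-/

set_option autoImplicit false
-- the mandated namespace repeats the single-problem summit's segment (`HodgeConjecture.HodgeConjecture`)
set_option linter.dupNamespace false

noncomputable section

open Set Function
open scoped ValuativeRel Matrix MatrixGroups
open SimpleGraph Matrix ValuativeRel
open Literature.NumberTheory.Automorphic
open Literature.NumberTheory.Automorphic.HermitianLatticeTree
open Literature.Combinatorics.SimpleGraph

namespace Summit.HodgeConjecture.HodgeConjecture.R90.S6

section Two

variable {K : Type} [Field K] [Valued K (WithZero (Multiplicative ℤ))] [ValuativeRel K]
  [(Valued.v : Valuation K (WithZero (Multiplicative ℤ))).Compatible] {σ : K →+* K} {ϖ : K}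

/-! ## §1 The compression `δ = c·1 + (a−c)·E` on lattices: the column test -/

omit [Valued K (WithZero (Multiplicative ℤ))] [ValuativeRel K] [(Valued.v : Valuation K (WithZero (Multiplicative ℤ))).Compatible] in
/-- **`δ·f = c f + (a − c) e (f₀ − f₁)·(1, −1)`** for `δ = !![e(a+c), −e(a−c); −e(a−c), e(a+c)]`, `2e = 1`: the compression is `c·1 + (a−c)·E`, `E = e(1 − J₂)` the projection
onto the `a`-eigenline `K·(1,−1)` along the `c`-eigenline `K·(1,1)`. [cite: Rogawski1990, §4.9 p. 55] [cite: LabesseLanglands1979, §2] -/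
theorem compression_mulVec {e a c : K} (h2e : 2 * e = 1) (δ : Matrix (Fin 2) (Fin 2) K)
    (hδ : δ = !![e * (a + c), -(e * (a - c)); -(e * (a - c)), e * (a + c)]) (f : Fin 2 → K) :
    δ *ᵥ f = c • f + ((a - c) * e * (f 0 - f 1)) • ![(1 : K), -1] := by
  subst hδ
  ext i
  fin_cases i
  · simp [Matrix.mulVec, dotProduct, Fin.sum_univ_two]
    linear_combination c * f 0 * h2e
  · simp [Matrix.mulVec, dotProduct, Fin.sum_univ_two]
    linear_combination c * f 1 * h2e

omit [Valued K (WithZero (Multiplicative ℤ))] [(Valued.v : Valuation K (WithZero (Multiplicative ℤ))).Compatible] in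
/-- **The column test**: for `c ∈ 𝒪`, `δ·latt F ≤ latt F ↔` for both columns `f_j` of `F`, `(a − c) e (f_{0j} − f_{1j})·(1, −1) ∈ latt F` (`δ f_j = c f_j + …` and
`c f_j ∈ latt F`). [cite: Kottwitz1986BaseChangeUnits, §3] [cite: Serre1980Trees, II.1.1] -/
theorem mapGL_latt_le_iff_compression {e a c : K} (h2e : 2 * e = 1) (hcO : c ∈ 𝒪[K]) (δ : GL (Fin 2) K)
    (hδ : (δ : Matrix (Fin 2) (Fin 2) K) = !![e * (a + c), -(e * (a - c)); -(e * (a - c)), e * (a + c)]) (F : GL (Fin 2) K) :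
    mapGL δ (latt (F : Matrix (Fin 2) (Fin 2) K)) ≤ latt (F : Matrix (Fin 2) (Fin 2) K) ↔
      ∀ j : Fin 2, ((a - c) * e * ((F : Matrix (Fin 2) (Fin 2) K) 0 j - (F : Matrix (Fin 2) (Fin 2) K) 1 j)) • ![(1 : K), -1] ∈
        latt (F : Matrix (Fin 2) (Fin 2) K) := by
  rw [mapGL_latt, Units.val_mul]
  have hspan : latt ((δ : Matrix (Fin 2) (Fin 2) K) * (F : Matrix (Fin 2) (Fin 2) K)) ≤ latt (F : Matrix (Fin 2) (Fin 2) K) ↔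
      ∀ j : Fin 2, ((δ : Matrix (Fin 2) (Fin 2) K) * (F : Matrix (Fin 2) (Fin 2) K))ᵀ j ∈ latt (F : Matrix (Fin 2) (Fin 2) K) :=
    ⟨fun h j => h (Submodule.subset_span ⟨j, rfl⟩), fun h => Submodule.span_le.2 (Set.range_subset_iff.2 h)⟩
  rw [hspan]
  refine forall_congr' fun j => ?_
  have hcol : ((δ : Matrix (Fin 2) (Fin 2) K) * (F : Matrix (Fin 2) (Fin 2) K))ᵀ j = (δ : Matrix (Fin 2) (Fin 2) K) *ᵥ ((F : Matrix (Fin 2) (Fin 2) K)ᵀ j) :=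
    (mulVec_transpose_apply _ _ j).symm
  have hmem : c • (F : Matrix (Fin 2) (Fin 2) K)ᵀ j ∈ latt (F : Matrix (Fin 2) (Fin 2) K) :=
    Submodule.smul_mem (latt (F : Matrix (Fin 2) (Fin 2) K)) (⟨c, hcO⟩ : 𝒪[K]) (Submodule.subset_span ⟨j, rfl⟩)
  rw [hcol, compression_mulVec h2e _ hδ, Submodule.add_mem_iff_right _ hmem, Matrix.transpose_apply, Matrix.transpose_apply]

/-! ## §2 The frame tests -/

omit [ValuativeRel K] [(Valued.v : Valuation K (WithZero (Multiplicative ℤ))).Compatible] in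
/-- Local bookkeeping copy (prefixed, private; the general letter is ★ `UnitaryGroup.v_eq_one_of_map_mul_self_eq_one` [UnitaryLatticeTreeFramesOfInvolution], not imported
here to keep the `U(1,1)` chain free of the `U(3)` tree files): a norm-one `a` (`σ a · a = 1`) has `v a = 1`. [cite: Jacobowitz1962, §4] -/
private theorem compressionFrame_v_eq_one_of_norm_eq_one (hd : HermitianLattice.UnramifiedLocalConjDatum σ ϖ) {a : K} (ha : σ a * a = 1) :
    Valued.v a = 1 := by
  have h : Valued.v a * Valued.v a = 1 := by
    have h' : Valued.v (σ a * a) = 1 := by rw [ha, map_one]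
    rwa [map_mul, hd.vσ] at h'
  rcases lt_trichotomy (Valued.v a) 1 with hlt | heq | hgt
  · exfalso
    have := mul_lt_one_of_lt_of_le hlt hlt.le
    exact absurd h this.ne
  · exact heq
  · exfalso
    have : 1 < Valued.v a * Valued.v a := lt_of_lt_of_le hgt (le_mul_of_one_le_right' hgt.le)
    exact absurd h this.ne'

/-- **THE FRAME TEST, sufficiency**: in a frame `latt (P·diag(ϖ^α, ϖ^β))` (`P ∈ GL₂(𝒪)`, `α ≤ β`) with `β − α ≤ n = v(a − c)`, `δ` maps the lattice into itself: every column
test of ★ `mem_latt_mul_diagonal_iff` reads `|ϖ|^{c_j − c_i}·|a − c|·(integral) ≤ 1` with `c_i − c_j ≤ β − α ≤ n`. [cite: Serre1980Trees, II.1.1] [cite: LabesseLanglands1979, §2] -/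
theorem mapGL_latt_frame_le_of_le (hd : HermitianLattice.UnramifiedLocalConjDatum σ ϖ) (h2 : Valued.v (2 : K) = 1)
    {e a c : K} (h2e : 2 * e = 1) (ha : σ a * a = 1) (hc : σ c * c = 1) {n : ℕ} (hn : Valued.v (a - c) = WithZero.exp (-(n : ℤ)))
    (δ : GL (Fin 2) K) (hδ : (δ : Matrix (Fin 2) (Fin 2) K) = !![e * (a + c), -(e * (a - c)); -(e * (a - c)), e * (a + c)])
    (P : GL (Fin 2) K) (hP : P ∈ glInt 2 K) {α β : ℤ} (hαβ : α ≤ β) (hle : β - α ≤ n) :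
    mapGL δ (latt ((P : Matrix (Fin 2) (Fin 2) K) * Matrix.diagonal ![ϖ ^ α, ϖ ^ β])) ≤
      latt ((P : Matrix (Fin 2) (Fin 2) K) * Matrix.diagonal ![ϖ ^ α, ϖ ^ β]) := by
  have hϖ0 : ϖ ≠ 0 := CartanUnique.uniformizer_ne_zero hd.vϖ
  have hva : Valued.v a = 1 := compressionFrame_v_eq_one_of_norm_eq_one hd ha
  have hvc : Valued.v c = 1 := compressionFrame_v_eq_one_of_norm_eq_one hd hc
  have hve : Valued.v e = 1 := by
    have h := congrArg Valued.v h2e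
    rw [map_mul, h2, one_mul, map_one] at h
    exact h
  have hcO : c ∈ 𝒪[K] := (v_le_one_iff_mem_integer c).1 hvc.le
  obtain ⟨hPint, hPinv⟩ := (mem_glInt_iff_forall_v_le_one P).1 hP
  have hF : (P : Matrix (Fin 2) (Fin 2) K) * Matrix.diagonal ![ϖ ^ α, ϖ ^ β] =
      ((P * zpowDiagGL (n := 2) hϖ0 ![α, β] : GL (Fin 2) K) : Matrix (Fin 2) (Fin 2) K) := by
    rw [Units.val_mul, coe_zpowDiagGL_two]
  have hd0 : ∀ i, (![ϖ ^ α, ϖ ^ β] : Fin 2 → K) i ≠ 0 := by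
    intro i; fin_cases i <;> simp [zpow_ne_zero _ hϖ0]
  rw [hF, mapGL_latt_le_iff_compression h2e hcO δ hδ, ← hF]
  intro j
  rw [mem_latt_mul_diagonal_iff P hd0]
  intro i
  rw [← v_le_one_iff_mem_integer, Matrix.mulVec_smul, Pi.smul_apply, smul_eq_mul, Matrix.mul_diagonal, Matrix.mul_diagonal]
  -- the exponents `c = (α, β)`
  obtain ⟨ci, hci⟩ : ∃ ci : ℤ, (![ϖ ^ α, ϖ ^ β] : Fin 2 → K) i = ϖ ^ ci ∧ (ci = α ∨ ci = β) := by
    fin_cases i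
    · exact ⟨α, rfl, Or.inl rfl⟩
    · exact ⟨β, rfl, Or.inr rfl⟩
  obtain ⟨cj, hcj⟩ : ∃ cj : ℤ, (![ϖ ^ α, ϖ ^ β] : Fin 2 → K) j = ϖ ^ cj ∧ (cj = α ∨ cj = β) := by
    fin_cases j
    · exact ⟨α, rfl, Or.inl rfl⟩
    · exact ⟨β, rfl, Or.inr rfl⟩
  rw [hci.1, hcj.1]
  have hcc : ci - cj ≤ n := by
    rcases hci.2 with h | h <;> rcases hcj.2 with h' | h' <;> subst h <;> subst h' <;> omega
  -- `(ϖ^{c_i})⁻¹ · ((a−c) e (P₀ⱼ ϖ^{c_j} − P₁ⱼ ϖ^{c_j}) · r_i) = (ϖ^{c_j − c_i} (a − c)) · (e ((P₀ⱼ − P₁ⱼ) r_i))`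
  have key : (ϖ ^ ci)⁻¹ * ((a - c) * e * ((P : Matrix (Fin 2) (Fin 2) K) 0 j * ϖ ^ cj - (P : Matrix (Fin 2) (Fin 2) K) 1 j * ϖ ^ cj) *
        ((((P⁻¹ : GL (Fin 2) K) : Matrix (Fin 2) (Fin 2) K) *ᵥ ![(1 : K), -1]) i)) =
      (ϖ ^ (cj - ci) * (a - c)) * (e * (((P : Matrix (Fin 2) (Fin 2) K) 0 j - (P : Matrix (Fin 2) (Fin 2) K) 1 j) *
        ((((P⁻¹ : GL (Fin 2) K) : Matrix (Fin 2) (Fin 2) K) *ᵥ ![(1 : K), -1]) i))) := by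
    rw [zpow_sub₀ hϖ0, div_eq_mul_inv]
    ring
  rw [key, map_mul]
  -- integral factors
  have hr : Valued.v ((((P⁻¹ : GL (Fin 2) K) : Matrix (Fin 2) (Fin 2) K) *ᵥ ![(1 : K), -1]) i) ≤ 1 := by
    rw [Matrix.mulVec, dotProduct, Fin.sum_univ_two]
    refine Valuation.map_add_le _ ?_ ?_
    · rw [map_mul]; exact mul_le_one' (hPinv i 0) (by simp)
    · rw [map_mul, Matrix.cons_val_one, Matrix.cons_val_zero, Valuation.map_neg, map_one]; exact mul_le_one' (hPinv i 1) le_rfl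
  have hp : Valued.v ((P : Matrix (Fin 2) (Fin 2) K) 0 j - (P : Matrix (Fin 2) (Fin 2) K) 1 j) ≤ 1 :=
    Valuation.map_sub_le _ (hPint 0 j) (hPint 1 j)
  have h2nd : Valued.v (e * (((P : Matrix (Fin 2) (Fin 2) K) 0 j - (P : Matrix (Fin 2) (Fin 2) K) 1 j) *
      ((((P⁻¹ : GL (Fin 2) K) : Matrix (Fin 2) (Fin 2) K) *ᵥ ![(1 : K), -1]) i))) ≤ 1 := by
    rw [map_mul, map_mul, hve, one_mul]; exact mul_le_one' hp hr
  have h1st : Valued.v (ϖ ^ (cj - ci) * (a - c)) ≤ 1 := by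
    rw [map_mul, CartanUnique.v_uniformizer_zpow hd.vϖ, hn, ← WithZero.exp_add, ← WithZero.exp_zero, WithZero.exp_le_exp]
    omega
  exact mul_le_one' h1st h2nd

/-- **THE FRAME TEST, necessity**: if `δ` maps `latt (P·diag(ϖ^{−⌊N∕2⌋}, ϖ^{⌈N∕2⌉}))` into itself and `N > n = v(a − c)`, then the column-`0` test at row `1` forces
`|(x − y)·r₁| < 1`, `(x, y)` the first column of `P`, `r₁ = (P⁻¹(1,−1))₁`. [cite: Serre1980Trees, II.1.1] [cite: LabesseLanglands1979, §2] -/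
theorem v_lt_one_of_mapGL_latt_frame_le (hd : HermitianLattice.UnramifiedLocalConjDatum σ ϖ) (h2 : Valued.v (2 : K) = 1)
    {e a c : K} (h2e : 2 * e = 1) (hc : σ c * c = 1) {n : ℕ} (hn : Valued.v (a - c) = WithZero.exp (-(n : ℤ)))
    (δ : GL (Fin 2) K) (hδ : (δ : Matrix (Fin 2) (Fin 2) K) = !![e * (a + c), -(e * (a - c)); -(e * (a - c)), e * (a + c)])
    (P : GL (Fin 2) K) {N : ℕ} (hNn : n < N)
    (hle : mapGL δ (latt ((P : Matrix (Fin 2) (Fin 2) K) * Matrix.diagonal ![ϖ ^ (-((N / 2 : ℕ) : ℤ)), ϖ ^ (((N + 1) / 2 : ℕ) : ℤ)])) ≤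
      latt ((P : Matrix (Fin 2) (Fin 2) K) * Matrix.diagonal ![ϖ ^ (-((N / 2 : ℕ) : ℤ)), ϖ ^ (((N + 1) / 2 : ℕ) : ℤ)])) :
    Valued.v (((P : Matrix (Fin 2) (Fin 2) K) 0 0 - (P : Matrix (Fin 2) (Fin 2) K) 1 0) *
      ((((P⁻¹ : GL (Fin 2) K) : Matrix (Fin 2) (Fin 2) K) *ᵥ ![(1 : K), -1]) 1)) < 1 := by
  have hϖ0 : ϖ ≠ 0 := CartanUnique.uniformizer_ne_zero hd.vϖ
  have hvc : Valued.v c = 1 := compressionFrame_v_eq_one_of_norm_eq_one hd hc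
  have hve : Valued.v e = 1 := by
    have h := congrArg Valued.v h2e
    rw [map_mul, h2, one_mul, map_one] at h
    exact h
  have hcO : c ∈ 𝒪[K] := (v_le_one_iff_mem_integer c).1 hvc.le
  have hF : (P : Matrix (Fin 2) (Fin 2) K) * Matrix.diagonal ![ϖ ^ (-((N / 2 : ℕ) : ℤ)), ϖ ^ (((N + 1) / 2 : ℕ) : ℤ)] =
      ((P * zpowDiagGL (n := 2) hϖ0 ![-((N / 2 : ℕ) : ℤ), (((N + 1) / 2 : ℕ) : ℤ)] : GL (Fin 2) K) : Matrix (Fin 2) (Fin 2) K) := by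
    rw [Units.val_mul, coe_zpowDiagGL_two]
  have hd0 : ∀ i, (![ϖ ^ (-((N / 2 : ℕ) : ℤ)), ϖ ^ (((N + 1) / 2 : ℕ) : ℤ)] : Fin 2 → K) i ≠ 0 := by
    intro i; fin_cases i <;> simp [zpow_ne_zero _ hϖ0]
  rw [hF, mapGL_latt_le_iff_compression h2e hcO δ hδ, ← hF] at hle
  have h := (mem_latt_mul_diagonal_iff P hd0 _).1 (hle 0) 1
  rw [← v_le_one_iff_mem_integer, Matrix.mulVec_smul, Pi.smul_apply, smul_eq_mul, Matrix.mul_diagonal, Matrix.mul_diagonal] at h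
  simp only [Fin.isValue, Matrix.cons_val_zero, Matrix.cons_val_one] at h
  have key : (ϖ ^ (((N + 1) / 2 : ℕ) : ℤ))⁻¹ * ((a - c) * e * ((P : Matrix (Fin 2) (Fin 2) K) 0 0 * ϖ ^ (-((N / 2 : ℕ) : ℤ)) -
        (P : Matrix (Fin 2) (Fin 2) K) 1 0 * ϖ ^ (-((N / 2 : ℕ) : ℤ))) * ((((P⁻¹ : GL (Fin 2) K) : Matrix (Fin 2) (Fin 2) K) *ᵥ ![(1 : K), -1]) 1)) =
      (ϖ ^ (-((N / 2 : ℕ) : ℤ) - (((N + 1) / 2 : ℕ) : ℤ)) * (a - c) * e) * ((((P : Matrix (Fin 2) (Fin 2) K) 0 0 - (P : Matrix (Fin 2) (Fin 2) K) 1 0) *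
        ((((P⁻¹ : GL (Fin 2) K) : Matrix (Fin 2) (Fin 2) K) *ᵥ ![(1 : K), -1]) 1))) := by
    rw [zpow_sub₀ hϖ0, div_eq_mul_inv]
    ring
  rw [key, map_mul, map_mul, map_mul, hve, mul_one, CartanUnique.v_uniformizer_zpow hd.vϖ, hn, ← WithZero.exp_add] at h
  have hNN : -(-((N / 2 : ℕ) : ℤ) - (((N + 1) / 2 : ℕ) : ℤ)) + -(n : ℤ) = (N : ℤ) - n := by omega
  rw [hNN] at h
  by_contra hge
  rw [not_lt] at hge
  have h' : WithZero.exp ((N : ℤ) - n) ≤ 1 :=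
    le_trans (by simpa using mul_le_mul_right hge (WithZero.exp ((N : ℤ) - n))) h
  rw [← WithZero.exp_zero, WithZero.exp_le_exp] at h'
  omega

/-! ## §3 The residual impossibility -/

/-- **The residual contradiction**: for `P ∈ GL₂(𝒪)` with first column `(x, y)`, if `|σ(x)y + σ(y)x| < 1` (the vector `(x̄, ȳ)` is isotropic for the residual hermitian form
`antidiag(1,1)`) and `|(x − y)·r₁| < 1` with `r = P⁻¹(1,−1)` (`(x̄, ȳ)` is an eigenvector of the projection `Ē` onto `(1,−1)` along `(1,1)`), then `x, y ∈ 𝔪` — impossible for a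
column of an invertible integral matrix.  (Residue characteristic `≠ 2`: the eigenlines `(1, ±1)` of `Ē` have `h̄ = ±2 ≠ 0`.) [cite: Jacobowitz1962, §4] [cite: Rogawski1990, §4.9 p. 55] -/
theorem false_of_v_lt_one_of_frame (hd : HermitianLattice.UnramifiedLocalConjDatum σ ϖ) (h2 : Valued.v (2 : K) = 1) (P : GL (Fin 2) K) (hP : P ∈ glInt 2 K)
    (hG : Valued.v (σ ((P : Matrix (Fin 2) (Fin 2) K) 0 0) * (P : Matrix (Fin 2) (Fin 2) K) 1 0 + σ ((P : Matrix (Fin 2) (Fin 2) K) 1 0) * (P : Matrix (Fin 2) (Fin 2) K) 0 0) < 1)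
    (hr : Valued.v (((P : Matrix (Fin 2) (Fin 2) K) 0 0 - (P : Matrix (Fin 2) (Fin 2) K) 1 0) *
      ((((P⁻¹ : GL (Fin 2) K) : Matrix (Fin 2) (Fin 2) K) *ᵥ ![(1 : K), -1]) 1)) < 1) : False := by
  obtain ⟨hPint, hPinv⟩ := (mem_glInt_iff_forall_v_le_one P).1 hP
  set x := (P : Matrix (Fin 2) (Fin 2) K) 0 0 with hx
  set y := (P : Matrix (Fin 2) (Fin 2) K) 1 0 with hy
  set R := ((P⁻¹ : GL (Fin 2) K) : Matrix (Fin 2) (Fin 2) K) with hR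
  have hsub : ∀ {u w : K}, Valued.v u < 1 → Valued.v w < 1 → Valued.v (u - w) < 1 := fun hu hw => by
    rw [sub_eq_add_neg]; exact Valuation.map_add_lt _ hu (by rwa [Valuation.map_neg])
  -- determinants of `P` and `P⁻¹` are units
  have hdetP : Valued.v (P : Matrix (Fin 2) (Fin 2) K).det = 1 := (v_eq_one_iff_valuation_eq_one _).2 (valuation_det_eq_one_of_mem_glInt hP)
  have hdetR : Valued.v R.det = 1 := (v_eq_one_iff_valuation_eq_one _).2 (valuation_det_eq_one_of_mem_glInt (inv_mem hP))
  -- `R P = 1`, entry `(1,0)`: `R₁₀ x + R₁₁ y = 0`; and `r₁ = R₁₀ − R₁₁`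
  have hRP : R 1 0 * x + R 1 1 * y = 0 := by
    have h := congrArg (fun M : Matrix (Fin 2) (Fin 2) K => M 1 0)
      (show R * (P : Matrix (Fin 2) (Fin 2) K) = 1 by rw [hR, ← Units.val_mul, inv_mul_cancel, Units.val_one])
    simpa [Matrix.mul_apply, Fin.sum_univ_two] using h
  have hr1 : (R *ᵥ ![(1 : K), -1]) 1 = R 1 0 - R 1 1 := by
    simp [Matrix.mulVec, dotProduct, Fin.sum_univ_two]; ring
  rw [hr1] at hr
  have hσx : Valued.v (σ x) = Valued.v x := hd.vσ x
  -- `|x| < 1` and `|y| < 1` contradict `|det P| = 1`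
  have hconclude : Valued.v x < 1 → Valued.v y < 1 → False := by
    intro hx1 hy1
    have hlt : Valued.v (P : Matrix (Fin 2) (Fin 2) K).det < 1 := by
      rw [Matrix.det_fin_two, ← hx, ← hy]
      refine hsub ?_ ?_
      · rw [map_mul]; exact mul_lt_one_of_lt_of_le hx1 (hPint 1 1)
      · rw [map_mul]; exact Right.mul_lt_one_of_le_of_lt (hPint 0 1) hy1
    rw [hdetP] at hlt
    exact lt_irrefl _ hlt
  -- `|x| < 1` from an identity `2 σ(x) x = z` with `|z| < 1`
  have hx_of : ∀ {z : K}, Valued.v z < 1 → 2 * (σ x * x) = z → Valued.v x < 1 := by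
    intro z hz heq
    have h := congrArg Valued.v heq
    rw [map_mul, map_mul, h2, one_mul, hσx] at h
    by_contra hge
    rw [not_lt] at hge
    have h1 : 1 ≤ Valued.v x * Valued.v x := Left.one_le_mul hge hge
    rw [h] at h1
    exact absurd hz (not_lt.2 h1)
  by_cases hxy : Valued.v (x - y) < 1
  · -- `x ≡ y`: `2 σ(x) x = G₀₀ − σ(x)(y − x) − σ(y − x) x`
    have hyx : Valued.v (y - x) < 1 := by rwa [← Valuation.map_neg, neg_sub] at hxy
    have hz : Valued.v (σ x * y + σ y * x - σ x * (y - x) - σ (y - x) * x) < 1 := by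
      refine hsub (hsub hG ?_) ?_
      · rw [map_mul, hσx]; exact Right.mul_lt_one_of_le_of_lt (hPint 0 0) hyx
      · rw [map_mul, hd.vσ]; exact mul_lt_one_of_lt_of_le hyx (hPint 0 0)
    have hx1 := hx_of hz (by rw [map_sub]; ring)
    have hy1 : Valued.v y < 1 := by
      rw [show y = x + (y - x) by ring]; exact Valuation.map_add_lt _ hx1 hyx
    exact hconclude hx1 hy1
  · -- `x ≢ y`: then `|R₁₀ − R₁₁| < 1`, `R₁₁` is a unit, and `R₁₁(x + y) = −(R₁₀ − R₁₁) x` gives `x ≡ −y`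
    have hr' : Valued.v (R 1 0 - R 1 1) < 1 := by
      rw [not_lt] at hxy
      have hxy1 : Valued.v (x - y) = 1 := le_antisymm (Valuation.map_sub_le _ (hPint 0 0) (hPint 1 0)) hxy
      rwa [map_mul, hxy1, one_mul] at hr
    have hR11 : Valued.v (R 1 1) = 1 := by
      by_contra hne
      have hlt : Valued.v (R 1 1) < 1 := lt_of_le_of_ne (hPinv 1 1) hne
      have hR10 : Valued.v (R 1 0) < 1 := by
        rw [show R 1 0 = (R 1 0 - R 1 1) + R 1 1 by ring]; exact Valuation.map_add_lt _ hr' hlt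
      have hdlt : Valued.v R.det < 1 := by
        rw [Matrix.det_fin_two]
        refine hsub ?_ ?_
        · rw [map_mul]; exact Right.mul_lt_one_of_le_of_lt (hPinv 0 0) hlt
        · rw [map_mul]; exact Right.mul_lt_one_of_le_of_lt (hPinv 0 1) hR10
      rw [hdetR] at hdlt
      exact lt_irrefl _ hdlt
    have hxy' : Valued.v (x + y) < 1 := by
      have hid : R 1 1 * (x + y) = -((R 1 0 - R 1 1) * x) := by linear_combination hRP
      have h := congrArg Valued.v hid
      rw [map_mul, hR11, one_mul, Valuation.map_neg, map_mul] at h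
      rw [h]; exact mul_lt_one_of_lt_of_le hr' (hPint 0 0)
    have hz : Valued.v (-(σ x * y + σ y * x - σ x * (x + y) - σ (x + y) * x)) < 1 := by
      rw [Valuation.map_neg]
      refine hsub (hsub hG ?_) ?_
      · rw [map_mul, hσx]; exact Right.mul_lt_one_of_le_of_lt (hPint 0 0) hxy'
      · rw [map_mul, hd.vσ]; exact mul_lt_one_of_lt_of_le hxy' (hPint 0 0)
    have hx1 := hx_of hz (by rw [map_add]; ring)
    have hy1 : Valued.v y < 1 := by
      rw [show y = (x + y) + -x by ring]; exact Valuation.map_add_lt _ hxy' (by rwa [Valuation.map_neg])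
    exact hconclude hx1 hy1


end Two

end Summit.HodgeConjecture.HodgeConjecture.R90.S6

end
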